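import Summits.AtomisticToContinuum.Crystallization.Theorems.FrustratedLawDichotomyStrainedPatchHomValueT2SlopeSoundB

/-!
# (I1) slope part K — UNPACKING `t2SlopeT2` (`…HomValueT2Track` §14b): its flag is the slope fold's flag and its `G`-triple is `f + j + h + r` read off the
# fold (critic row 1674 (B) (I1) docket item 3 `slopeT2_sound`, eleventh instalment; 27623 `(H) HomFloor`; decomp-a2c hand-1 g49)

Definitional bookkeeping so that the assembly can quote `foldl_slope_spec` (part B) on the report actually run.  No definitions; 0 sorry; standard axioms.
`--supports stmt-AtomisticToContinuum-27623`.
-/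

namespace Summit.AtomisticToContinuum.Crystallization.Theorems.FrustratedLawDichotomyStrainedPatchHomValueT2Kit

open Literature.Analysis.ValidatedNumerics.Numerics
open Summit.AtomisticToContinuum.Crystallization.Theorems.FrustratedLawDichotomyStrainedPatchHomEntryGramHcp (shufFI)
open Summit.AtomisticToContinuum.Crystallization.Theorems.FrustratedLawDichotomyStrainedPatchHomCurvCentreKit (boxE cenE cenX)

/-- The flag of `t2SlopeT2` is the flag of the slope fold over `nearB c (trackW aP w)`. [formal bookkeeping] -/
theorem t2SlopeT2_flag (c w : (Fin 3 × Fin 3) ⊕ Fin 3 → ℤ) (aP : Fin 3 → Fin 6 → ℤ) :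
    (t2SlopeT2 c w aP).1 = ((nearB c (trackW aP w)).foldl (fun A b =>
        match mkDRec 9 (cenE c) (qB (cenX c) b), mkDRec 9 (boxE c (trackW aP w)) (qB (shufFI c (trackW aP w)) b) with
        | some Rp, some Rb => accSlope aP (Array.ofFn fun p : Fin 9 => foldW (trackW aP w) p) Rp Rb A
        | _, _ => (⟨false, A.fc, A.jc, A.hp, A.rp⟩ : AccS)) (⟨true, zeroArr 3, zeroArr 18, Array.replicate 3 0, Array.replicate 3 0⟩ : AccS)).ok := by
  unfold t2SlopeT2
  rfl

/-- The `G`-triple of `t2SlopeT2` is `f_a + j_a + h_a + r_a` read off the slope fold (`a = 0, 1, 2`). [formal bookkeeping] -/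
theorem t2SlopeT2_G (c w : (Fin 3 × Fin 3) ⊕ Fin 3 → ℤ) (aP : Fin 3 → Fin 6 → ℤ) :
    (t2SlopeT2 c w aP).2.1 = ((((nearB c (trackW aP w)).foldl (fun A b =>
        match mkDRec 9 (cenE c) (qB (cenX c) b), mkDRec 9 (boxE c (trackW aP w)) (qB (shufFI c (trackW aP w)) b) with
        | some Rp, some Rb => accSlope aP (Array.ofFn fun p : Fin 9 => foldW (trackW aP w) p) Rp Rb A
        | _, _ => (⟨false, A.fc, A.jc, A.hp, A.rp⟩ : AccS)) (⟨true, zeroArr 3, zeroArr 18, Array.replicate 3 0, Array.replicate 3 0⟩ : AccS)).fc.getD 0 fi0).absHi + cdiv ((List.range 6).foldl (fun s e => s + (((nearB c (trackW aP w)).foldl (fun A b =>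
        match mkDRec 9 (cenE c) (qB (cenX c) b), mkDRec 9 (boxE c (trackW aP w)) (qB (shufFI c (trackW aP w)) b) with
        | some Rp, some Rb => accSlope aP (Array.ofFn fun p : Fin 9 => foldW (trackW aP w) p) Rp Rb A
        | _, _ => (⟨false, A.fc, A.jc, A.hp, A.rp⟩ : AccS)) (⟨true, zeroArr 3, zeroArr 18, Array.replicate 3 0, Array.replicate 3 0⟩ : AccS)).jc.getD (6 * 0 + e) fi0).absHi * (Array.ofFn fun p : Fin 9 => foldW (trackW aP w) p).getD e 0) 0) (SC : ℤ) + cdiv (((nearB c (trackW aP w)).foldl (fun A b =>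
        match mkDRec 9 (cenE c) (qB (cenX c) b), mkDRec 9 (boxE c (trackW aP w)) (qB (shufFI c (trackW aP w)) b) with
        | some Rp, some Rb => accSlope aP (Array.ofFn fun p : Fin 9 => foldW (trackW aP w) p) Rp Rb A
        | _, _ => (⟨false, A.fc, A.jc, A.hp, A.rp⟩ : AccS)) (⟨true, zeroArr 3, zeroArr 18, Array.replicate 3 0, Array.replicate 3 0⟩ : AccS)).hp.getD 0 0) (SC : ℤ) + cdiv (((nearB c (trackW aP w)).foldl (fun A b =>
        match mkDRec 9 (cenE c) (qB (cenX c) b), mkDRec 9 (boxE c (trackW aP w)) (qB (shufFI c (trackW aP w)) b) with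
        | some Rp, some Rb => accSlope aP (Array.ofFn fun p : Fin 9 => foldW (trackW aP w) p) Rp Rb A
        | _, _ => (⟨false, A.fc, A.jc, A.hp, A.rp⟩ : AccS)) (⟨true, zeroArr 3, zeroArr 18, Array.replicate 3 0, Array.replicate 3 0⟩ : AccS)).rp.getD 0 0) (2 * (SC : ℤ)),
      (((nearB c (trackW aP w)).foldl (fun A b =>
        match mkDRec 9 (cenE c) (qB (cenX c) b), mkDRec 9 (boxE c (trackW aP w)) (qB (shufFI c (trackW aP w)) b) with
        | some Rp, some Rb => accSlope aP (Array.ofFn fun p : Fin 9 => foldW (trackW aP w) p) Rp Rb A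
        | _, _ => (⟨false, A.fc, A.jc, A.hp, A.rp⟩ : AccS)) (⟨true, zeroArr 3, zeroArr 18, Array.replicate 3 0, Array.replicate 3 0⟩ : AccS)).fc.getD 1 fi0).absHi + cdiv ((List.range 6).foldl (fun s e => s + (((nearB c (trackW aP w)).foldl (fun A b =>
        match mkDRec 9 (cenE c) (qB (cenX c) b), mkDRec 9 (boxE c (trackW aP w)) (qB (shufFI c (trackW aP w)) b) with
        | some Rp, some Rb => accSlope aP (Array.ofFn fun p : Fin 9 => foldW (trackW aP w) p) Rp Rb A
        | _, _ => (⟨false, A.fc, A.jc, A.hp, A.rp⟩ : AccS)) (⟨true, zeroArr 3, zeroArr 18, Array.replicate 3 0, Array.replicate 3 0⟩ : AccS)).jc.getD (6 * 1 + e) fi0).absHi * (Array.ofFn fun p : Fin 9 => foldW (trackW aP w) p).getD e 0) 0) (SC : ℤ) + cdiv (((nearB c (trackW aP w)).foldl (fun A b =>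
        match mkDRec 9 (cenE c) (qB (cenX c) b), mkDRec 9 (boxE c (trackW aP w)) (qB (shufFI c (trackW aP w)) b) with
        | some Rp, some Rb => accSlope aP (Array.ofFn fun p : Fin 9 => foldW (trackW aP w) p) Rp Rb A
        | _, _ => (⟨false, A.fc, A.jc, A.hp, A.rp⟩ : AccS)) (⟨true, zeroArr 3, zeroArr 18, Array.replicate 3 0, Array.replicate 3 0⟩ : AccS)).hp.getD 1 0) (SC : ℤ) + cdiv (((nearB c (trackW aP w)).foldl (fun A b =>
        match mkDRec 9 (cenE c) (qB (cenX c) b), mkDRec 9 (boxE c (trackW aP w)) (qB (shufFI c (trackW aP w)) b) with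
        | some Rp, some Rb => accSlope aP (Array.ofFn fun p : Fin 9 => foldW (trackW aP w) p) Rp Rb A
        | _, _ => (⟨false, A.fc, A.jc, A.hp, A.rp⟩ : AccS)) (⟨true, zeroArr 3, zeroArr 18, Array.replicate 3 0, Array.replicate 3 0⟩ : AccS)).rp.getD 1 0) (2 * (SC : ℤ)),
      (((nearB c (trackW aP w)).foldl (fun A b =>
        match mkDRec 9 (cenE c) (qB (cenX c) b), mkDRec 9 (boxE c (trackW aP w)) (qB (shufFI c (trackW aP w)) b) with
        | some Rp, some Rb => accSlope aP (Array.ofFn fun p : Fin 9 => foldW (trackW aP w) p) Rp Rb A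
        | _, _ => (⟨false, A.fc, A.jc, A.hp, A.rp⟩ : AccS)) (⟨true, zeroArr 3, zeroArr 18, Array.replicate 3 0, Array.replicate 3 0⟩ : AccS)).fc.getD 2 fi0).absHi + cdiv ((List.range 6).foldl (fun s e => s + (((nearB c (trackW aP w)).foldl (fun A b =>
        match mkDRec 9 (cenE c) (qB (cenX c) b), mkDRec 9 (boxE c (trackW aP w)) (qB (shufFI c (trackW aP w)) b) with
        | some Rp, some Rb => accSlope aP (Array.ofFn fun p : Fin 9 => foldW (trackW aP w) p) Rp Rb A
        | _, _ => (⟨false, A.fc, A.jc, A.hp, A.rp⟩ : AccS)) (⟨true, zeroArr 3, zeroArr 18, Array.replicate 3 0, Array.replicate 3 0⟩ : AccS)).jc.getD (6 * 2 + e) fi0).absHi * (Array.ofFn fun p : Fin 9 => foldW (trackW aP w) p).getD e 0) 0) (SC : ℤ) + cdiv (((nearB c (trackW aP w)).foldl (fun A b =>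
        match mkDRec 9 (cenE c) (qB (cenX c) b), mkDRec 9 (boxE c (trackW aP w)) (qB (shufFI c (trackW aP w)) b) with
        | some Rp, some Rb => accSlope aP (Array.ofFn fun p : Fin 9 => foldW (trackW aP w) p) Rp Rb A
        | _, _ => (⟨false, A.fc, A.jc, A.hp, A.rp⟩ : AccS)) (⟨true, zeroArr 3, zeroArr 18, Array.replicate 3 0, Array.replicate 3 0⟩ : AccS)).hp.getD 2 0) (SC : ℤ) + cdiv (((nearB c (trackW aP w)).foldl (fun A b =>
        match mkDRec 9 (cenE c) (qB (cenX c) b), mkDRec 9 (boxE c (trackW aP w)) (qB (shufFI c (trackW aP w)) b) with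
        | some Rp, some Rb => accSlope aP (Array.ofFn fun p : Fin 9 => foldW (trackW aP w) p) Rp Rb A
        | _, _ => (⟨false, A.fc, A.jc, A.hp, A.rp⟩ : AccS)) (⟨true, zeroArr 3, zeroArr 18, Array.replicate 3 0, Array.replicate 3 0⟩ : AccS)).rp.getD 2 0) (2 * (SC : ℤ))) := by
  unfold t2SlopeT2
  rfl

end Summit.AtomisticToContinuum.Crystallization.Theorems.FrustratedLawDichotomyStrainedPatchHomValueT2Kit
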